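import Summits.BirchSwinnertonDyer.Rank1Residual.P2.PrintCf2SplitBadTwoReflectionPrimitive
import Summits.BirchSwinnertonDyer.Rank1Residual.P2.PrintCf2SplitBadTwoReadTwoCut
import Summits.BirchSwinnertonDyer.Rank1Residual.P2.PrintCf2SplitBadTwoShiftLift
import HarnessLib

set_option autoImplicit false

/-!
# R219-INST₂-CORE, gauge half: the reflection quotient `Q̄_β` read in `𝒪_ℂ⟦X⟧`, its congruence `Q̄_β ≡ 1 (mod 2)` in the
# DIVISIBILITY currency, the gauge unit `a_β = Q̄_β(0) ∈ 𝒪_ℂˣ` and the normalised quotient `P_β = a_β⁻¹ Q̄_β` (`P_β(0) = 1`)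

Cell `bsd-print-cf2`, typer `bsd-print-cf2-ty2` g45 (literature-prover seat; typer directory `Rank1Residual/P2/`, Theses-free, no
item): port P58 (part 1 of 2) of STUB-PLAN `stub_heegnerIndexLowerAtTwo` (crux `PrintCf2.SplitBadTwoLowerHalfOfFacts`,
stmt-BirchSwinnertonDyer-27851; CRITIC-ROWS-g42 rows 119–121 (α)/(β); sketch k1-g41 `3c421c26b5d9a924` PART M §A–§C VERBATIM, its verbatim
copies V1–V4 replaced by the ported modules `ReadTwoCut`, `ShiftLift`, `ReflectionPrimitive`).  HONEST FRAMING: nothing here proves BSD,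
the crux or the stub; no named fact, no `sorry`; the definitions (`thetaBar`, `reflQuotC`, `gaugeUnit`, `reflQuotN`) are explicit series /
units built from the tree's `compSeriesC` and `ReflectionPrimitive.reflQuot`.

* §A the currency bridge `coeffIdeal (span {a}) ⟷ (a ∣ coefficients)`: `map_mem_coeffIdeal_map`, `map_sub_one_mem_coeffIdeal_span`,
  `subst_mem_coeffIdeal`, `subst_sub_one_mem_coeffIdeal`, `span_singleton_unit_mul_eq`, `coeff_zero_sub_one`, `coeff_succ_sub_one`,
  ★ `sub_one_mem_coeffIdeal_span_iff`, `constantCoeff_C_inv_mul`, `dvd_coeff_succ_C_mul`.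
* §B units / principal units of `𝒪_ℂ` read through `θ` (`‖θ‖ ≤ 1` on `𝒪_ℂ` only): `norm_two_C2_lt_one`, `norm_sub_one_lt_one_of_two_dvd`,
  ★ `isUnit_of_norm_sub_one_lt_one`, `norm_one_sub_map_lt_one_of_two_dvd`, `two_dvd_evS_sub_one`.
* §C the witness: `thetaBar`, `constantCoeff_thetaBar`, `hasSubst_thetaBar`, `reflQuotC`, ★ `reflQuotC_sub_one_mem`,
  `two_dvd_coeff_succ_reflQuotC`, `two_dvd_constantCoeff_reflQuotC_sub_one`, `isUnit_constantCoeff_reflQuotC`, `gaugeUnit`, `coe_gaugeUnit`,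
  `reflQuotN`, ★ `constantCoeff_reflQuotN`, `two_dvd_coeff_succ_reflQuotN`.

References: [deShalit1987] Ch. I §3, II §4.12–4.14; [Rubin1991] §7.
-/

noncomputable section

namespace Summit.BirchSwinnertonDyer.Rank1Residual.P2.InstTwoCore

/-! ### §A  The currency bridge `coeffIdeal (span {a}) ⟷ (a ∣ coefficients)` — pure commutative algebra. -/
section Algebra

open PowerSeries
open Literature.NumberTheory.GaloisRepresentations.LubinTate (coeffIdeal mem_coeffIdeal_iff)

variable {A B : Type*} [CommRing A] [CommRing B]

/-- Functoriality of `coeffIdeal` under `PowerSeries.map`. -/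
theorem map_mem_coeffIdeal_map (f : A →+* B) {J : Ideal A} {G : PowerSeries A} (hG : G ∈ coeffIdeal J) :
    G.map f ∈ coeffIdeal (J.map f) :=
  mem_coeffIdeal_iff.mpr fun n => by
    rw [coeff_map]; exact Ideal.mem_map_of_mem f (mem_coeffIdeal_iff.mp hG n)

/-- … in the `G − 1 ∈ coeffIdeal (span {a})` shape of k3-g39's `reflQuot_sub_one_mem`. -/
theorem map_sub_one_mem_coeffIdeal_span (f : A →+* B) {a : A} {G : PowerSeries A}
    (hG : G - 1 ∈ coeffIdeal (Ideal.span {a})) : G.map f - 1 ∈ coeffIdeal (Ideal.span {f a}) := by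
  have h := map_mem_coeffIdeal_map f hG
  rw [map_sub, map_one, Ideal.map_span, Set.image_singleton] at h
  exact h

/-- `coeffIdeal J` is stable under substitution of a substitutable series (k3-g39's pattern, l. 601). -/
theorem subst_mem_coeffIdeal {φ : PowerSeries A} (hφ : PowerSeries.HasSubst φ) {J : Ideal A} {G : PowerSeries A}
    (hG : G ∈ coeffIdeal J) : PowerSeries.subst φ G ∈ coeffIdeal J :=
  mem_coeffIdeal_iff.mpr fun n => by
    rw [PowerSeries.coeff_subst' hφ]
    exact finsum_induction (· ∈ J) J.zero_mem (fun _ _ hx hy => J.add_mem hx hy)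
      fun d => by rw [smul_eq_mul]; exact J.mul_mem_right _ (mem_coeffIdeal_iff.mp hG d)

/-- … in the `G − 1` shape: the congruence `G ≡ 1` survives `∘φ` (the `∘ϑ̄` line never spends the congruence). -/
theorem subst_sub_one_mem_coeffIdeal {φ : PowerSeries A} (hφ : PowerSeries.HasSubst φ) {J : Ideal A}
    {G : PowerSeries A} (hG : G - 1 ∈ coeffIdeal J) : PowerSeries.subst φ G - 1 ∈ coeffIdeal J := by
  have h := subst_mem_coeffIdeal hφ hG
  rw [← PowerSeries.coe_substAlgHom hφ] at h ⊢
  rw [map_sub, map_one] at h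
  exact h

/-- RE-GAUGE: the congruence ideal sees the generator only up to units (`π' = u·2 ↦ 2`). -/
theorem span_singleton_unit_mul_eq {v : A} (hv : IsUnit v) (a : A) :
    Ideal.span ({v * a} : Set A) = Ideal.span {a} :=
  Ideal.span_singleton_mul_left_unit hv a

/-- `[X^0](P − 1) = P(0) − 1`. -/
theorem coeff_zero_sub_one (P : PowerSeries A) :
    PowerSeries.coeff 0 (P - 1) = PowerSeries.constantCoeff P - 1 := by
  rw [map_sub, PowerSeries.coeff_zero_eq_constantCoeff_apply, PowerSeries.coeff_zero_one]

/-- `[X^{n+1}](P − 1) = [X^{n+1}]P`. -/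
theorem coeff_succ_sub_one (P : PowerSeries A) (n : ℕ) :
    PowerSeries.coeff (n + 1) (P - 1) = PowerSeries.coeff (n + 1) P := by
  rw [map_sub, PowerSeries.coeff_one, if_neg (Nat.succ_ne_zero n), sub_zero]

/-- ★ **THE CURRENCY BRIDGE**: ideal currency (k3-g39 / tree `coeffIdeal`) ⟺ divisibility currency (J10's
`hP0`/`hP`).  The WEAKEST form J10 needs is the right-hand side with `P(0) − 1 = 0`. -/
theorem sub_one_mem_coeffIdeal_span_iff {a : A} {P : PowerSeries A} :
    P - 1 ∈ coeffIdeal (Ideal.span {a}) ↔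
      (a ∣ PowerSeries.constantCoeff P - 1) ∧ ∀ n : ℕ, a ∣ PowerSeries.coeff (n + 1) P := by
  rw [mem_coeffIdeal_iff]
  constructor
  · intro h
    exact ⟨by rw [← coeff_zero_sub_one]; exact Ideal.mem_span_singleton.mp (h 0),
      fun n => by rw [← coeff_succ_sub_one P n]; exact Ideal.mem_span_singleton.mp (h (n + 1))⟩
  · rintro ⟨h0, hs⟩ n
    cases n with
    | zero => rw [coeff_zero_sub_one]; exact Ideal.mem_span_singleton.mpr h0
    | succ n => rw [coeff_succ_sub_one]; exact Ideal.mem_span_singleton.mpr (hs n)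

/-- NORMALISATION of the constant term by a unit (the gauge `a ↦ 1`). -/
theorem constantCoeff_C_inv_mul (a : Aˣ) {P : PowerSeries A} (hP : PowerSeries.constantCoeff P = a) :
    PowerSeries.constantCoeff (PowerSeries.C ((↑a⁻¹ : A)) * P) = 1 := by
  rw [map_mul, PowerSeries.constantCoeff_C, hP, Units.inv_mul]

/-- … which does not disturb the divisibility of the higher coefficients. -/
theorem dvd_coeff_succ_C_mul (c : A) {a : A} {P : PowerSeries A}
    (hP : ∀ n : ℕ, a ∣ PowerSeries.coeff (n + 1) P) (n : ℕ) :
    a ∣ PowerSeries.coeff (n + 1) (PowerSeries.C c * P) := by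
  rw [PowerSeries.coeff_C_mul]; exact Dvd.dvd.mul_left (hP n) c

/-- Degenerate check (B68-style): `P = 1` satisfies the weakest form trivially. -/
example (a : A) : (1 : PowerSeries A) - 1 ∈ coeffIdeal (Ideal.span {a}) := by
  rw [sub_self]; exact (coeffIdeal (Ideal.span {a})).zero_mem

/-- Sanity check of the bridge on `P = 1 + C a · X`: constant coefficient `1`, `a ∣` every higher coefficient. -/
example (a : A) : (1 + PowerSeries.C a * PowerSeries.X : PowerSeries A) - 1 ∈ coeffIdeal (Ideal.span {a}) := by
  refine sub_one_mem_coeffIdeal_span_iff.mpr ⟨?_, fun n => ?_⟩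
  · simp
  · rw [map_add, PowerSeries.coeff_one, if_neg (Nat.succ_ne_zero n), zero_add, PowerSeries.coeff_C_mul,
      PowerSeries.coeff_X]
    split_ifs
    · exact ⟨1, by ring⟩
    · exact ⟨0, by ring⟩

end Algebra

/-! ### §B  Units and principal units of `𝒪_ℂ = CBall F`, read through `θ : ℂ_F → ℂ₂` with `‖θ‖ ≤ 1` on `𝒪_ℂ` only. -/
section Ball

open ValuativeRel IsLocalRing Field
open Literature.NumberTheory.Transcendental
open Literature.NumberTheory.GaloisRepresentations Literature.NumberTheory.GaloisRepresentations.IsNonarchimedeanLocalField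
  Literature.NumberTheory.GaloisRepresentations.LubinTate Literature.NumberTheory.PAdicHodge

variable {F : Type} [Field F] [ValuativeRel F] [TopologicalSpace F] [IsNonarchimedeanLocalField F]

/-- `‖2‖ < 1` in `ℂ₂` (k3-g40's `norm_two`). -/
theorem norm_two_C2_lt_one : ‖(2 : ℂ_[2])‖ < 1 := by
  rw [ReadTwoCut.norm_two]; norm_num

/-- `2 ∣ a − 1` in `𝒪_ℂ` ⟹ `‖a − 1‖ < 1` in `ℂ_F`. -/
theorem norm_sub_one_lt_one_of_two_dvd (h2 : ‖(2 : CompletedAlgClosure F)‖ < 1) {a : CBall F}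
    (ha : (2 : CBall F) ∣ a - 1) : ‖((a : CBall F) : CompletedAlgClosure F) - 1‖ < 1 := by
  obtain ⟨t, ht⟩ := ha
  have e2 : ((2 : CBall F) : CompletedAlgClosure F) = 2 := map_ofNat (CBall F).subtype 2
  have e : (a : CompletedAlgClosure F) - 1 = 2 * (t : CompletedAlgClosure F) := by
    have := congrArg (fun s : CBall F => (s : CompletedAlgClosure F)) ht
    push_cast at this
    rw [e2] at this
    exact this
  rw [e, norm_mul]
  calc ‖(2 : CompletedAlgClosure F)‖ * ‖(t : CompletedAlgClosure F)‖
      ≤ ‖(2 : CompletedAlgClosure F)‖ * 1 := by gcongr; exact (mem_unitBall_iff _).mp t.2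
    _ < 1 := by rw [mul_one]; exact h2

/-- ★ principal elements of `𝒪_ℂ` are UNITS of `𝒪_ℂ` (the gauge constant `a_β = Q̄_β(0)` is invertible in `𝒪_ℂ`). -/
theorem isUnit_of_norm_sub_one_lt_one {a : CBall F}
    (ha : ‖((a : CBall F) : CompletedAlgClosure F) - 1‖ < 1) : IsUnit a := by
  have ha1 : ‖(a : CompletedAlgClosure F)‖ = 1 :=
    IwasawaLog.norm_eq_one_of_norm_one_sub_lt (by rwa [norm_sub_rev] at ha)
  have ha0 : (a : CompletedAlgClosure F) ≠ 0 := fun h => by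
    rw [h, norm_zero] at ha1; exact zero_ne_one ha1
  let b : CBall F := ⟨(a : CompletedAlgClosure F)⁻¹, (mem_unitBall_iff _).mpr (by rw [norm_inv, ha1, inv_one])⟩
  exact IsUnit.of_mul_eq_one b (Subtype.ext (mul_inv_cancel₀ ha0))

variable (θ : CompletedAlgClosure F →+* ℂ_[2]) (hθ1 : ∀ z : CBall F, ‖θ (z : CompletedAlgClosure F)‖ ≤ 1)

include hθ1 in
/-- `2 ∣ a − 1` in `𝒪_ℂ` ⟹ `θ(a)` is a principal unit of `ℂ₂` — uses `hθ1` ONLY (no `hθlt`, cf. K-rule R221). -/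
theorem norm_one_sub_map_lt_one_of_two_dvd {a : CBall F} (ha : (2 : CBall F) ∣ a - 1) :
    ‖1 - θ ((a : CBall F) : CompletedAlgClosure F)‖ < 1 := by
  obtain ⟨t, ht⟩ := ha
  have e2 : ((2 : CBall F) : CompletedAlgClosure F) = 2 := map_ofNat (CBall F).subtype 2
  have e : (a : CompletedAlgClosure F) = 1 + 2 * (t : CompletedAlgClosure F) := by
    have := congrArg (fun s : CBall F => (s : CompletedAlgClosure F)) ht
    push_cast at this
    rw [e2] at this
    linear_combination this
  rw [e, map_add, map_one, map_mul, map_ofNat,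
    show (1 : ℂ_[2]) - (1 + 2 * θ (t : CompletedAlgClosure F)) = -(2 * θ (t : CompletedAlgClosure F)) by ring,
    norm_neg, norm_mul]
  calc ‖(2 : ℂ_[2])‖ * ‖θ (t : CompletedAlgClosure F)‖ ≤ ‖(2 : ℂ_[2])‖ * 1 := by gcongr; exact hθ1 t
    _ < 1 := by rw [mul_one]; exact norm_two_C2_lt_one

/-- `2 ∣ P(w) − 1` in `𝒪_ℂ` for `P(0) = 1`, `2 ∣ [X^{n+1}]P`, `w ∈ 𝔪_ℂ` (via k2-g41's half-lift `P = 1 + 2y`). -/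
theorem two_dvd_evS_sub_one {P : PowerSeries (CBall F)} (hP0 : PowerSeries.constantCoeff P = 1)
    (hP : ∀ n : ℕ, (2 : CBall F) ∣ PowerSeries.coeff (n + 1) P) (w : (maxNilIdealC F).toIdeal) :
    (2 : CBall F) ∣ evS (maxNilIdealC F) w P - 1 := by
  obtain ⟨y, -, hPy⟩ := ShiftLift.exists_eq_one_add_C_mul (2 : CBall F) P hP0 hP
  refine ⟨evS (maxNilIdealC F) w y, ?_⟩
  rw [hPy, map_add, map_one, map_mul, evS_C, add_sub_cancel_left]

end Ball

/-! ### §C  The witness: `ϑ̄`, `Q̄_β`, the gauge unit `a_β`, the normalised quotient `P_β`. -/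
section Witness

open ValuativeRel IsLocalRing Field
open Literature.NumberTheory.Transcendental
open Literature.NumberTheory.GaloisRepresentations Literature.NumberTheory.GaloisRepresentations.IsNonarchimedeanLocalField
  Literature.NumberTheory.GaloisRepresentations.LubinTate Literature.NumberTheory.PAdicHodge
  Literature.NumberTheory.EllipticCurves

variable {F : Type} [Field F] [ValuativeRel F] [TopologicalSpace F] [IsNonarchimedeanLocalField F]

attribute [local instance] ltNormUniformSpace ltNormIsUniformAddGroup rk1 nF nE fintypeResidueField

variable (hq : residueFieldCard F = 2) (h2 : (valuation F).IsUniformizer (((2 : ℕ) : 𝒪[F]) : F)) (u : 𝒪[F]ˣ)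
variable (E : IntermediateField F (AlgebraicClosure F)) [FiniteDimensional F E] [Normal F E] [IsGalois F E]
  (hE : E ≤ maxUnramified F) {σ₀ : absoluteGaloisGroup F} (hσ₀ : IsAbsArithFrob σ₀)
variable {ε : (maxUnramifiedCompletion F)ˣ}
  (hε : maxUnramifiedCompletion.galAut F σ₀ (ε : maxUnramifiedCompletion F) =
    algebraMap 𝒪[F] (maxUnramifiedCompletion F) (u : 𝒪[F]) * (ε : maxUnramifiedCompletion F))
variable (θ : CompletedAlgClosure F →+* ℂ_[2]) (hθc : Continuous θ)
  (hθ1 : ∀ z : CBall F, ‖θ (z : CompletedAlgClosure F)‖ ≤ 1)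

/-- `ϑ̄` — the comparison series of record read in `𝒪_ℂ⟦S⟧` (the tree's currency for points of the family:
`evalPt₁_compSeriesC_eq_mk_evS`).  It is `j`-FREE. -/
def thetaBar : PowerSeries (CBall F) := (compSeriesC h2 hσ₀ u hε).map (algebraMap (UnrCoeff F) (CBall F))

/-- `ϑ̄(0) = 0`. -/
theorem constantCoeff_thetaBar : PowerSeries.constantCoeff (thetaBar h2 u hσ₀ hε) = 0 :=
  constantCoeff_map_compSeriesC hσ₀ u hε h2

/-- `ϑ̄` is substitutable. -/
theorem hasSubst_thetaBar : PowerSeries.HasSubst (thetaBar h2 u hσ₀ hε) :=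
  PowerSeries.HasSubst.of_constantCoeff_zero' (constantCoeff_thetaBar h2 u hσ₀ hε)

/-- `Q̄_β` — k3-g39's reflection quotient `Q_β = g_β / τ_E g_β` read in `𝒪_ℂ⟦X⟧` along `𝒪_E → 𝒪_ℂ`
(`unitBallToCBall E`).  It is `j`-FREE. -/
def reflQuotC (β : RelNormCoherentUnits (isUniformizer_unit_mul h2 u) E) : PowerSeries (CBall F) :=
  (ReflectionPrimitive.reflQuot (isUniformizer_unit_mul h2 u) E hq hE hσ₀ β : PowerSeries (unitBall E)).map
    (unitBallToCBall E)

omit [Normal F E] [IsGalois F E] in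
/-- The congruence generator `π' = u·2` of the frame, read in `𝒪_ℂ`, is `(unit)·2`. -/
theorem unitBallToCBall_algebraMap_generator :
    unitBallToCBall E (algebraMap 𝒪[F] (unitBall E) ((u : 𝒪[F]) * ((2 : ℕ) : 𝒪[F]))) =
      unitBallToCBall E (algebraMap 𝒪[F] (unitBall E) (u : 𝒪[F])) * 2 := by
  rw [map_mul, map_mul, map_natCast, map_natCast, Nat.cast_ofNat]

omit [Normal F E] [IsGalois F E] in
/-- The unit `u` of the frame, read in `𝒪_ℂ`, is a unit. -/
theorem isUnit_unitBallToCBall_algebraMap_unit :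
    IsUnit (unitBallToCBall E (algebraMap 𝒪[F] (unitBall E) (u : 𝒪[F]))) :=
  (u.isUnit.map _).map _

/-- ★ STRONGEST AVAILABLE, RE-GAUGED: `Q̄_β − 1 ∈ coeffIdeal (2)` in `𝒪_ℂ⟦X⟧` — k3-g39's `reflQuot_sub_one_mem`
(ideal `(π')` of `𝒪_E`) pushed along `𝒪_E → 𝒪_ℂ` (`map_sub_one_mem_coeffIdeal_span`) and re-gauged `(u·2) = (2)`. -/
theorem reflQuotC_sub_one_mem (β : RelNormCoherentUnits (isUniformizer_unit_mul h2 u) E) :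
    reflQuotC hq h2 u E hE hσ₀ β - 1 ∈ coeffIdeal (Ideal.span {(2 : CBall F)}) := by
  have h := map_sub_one_mem_coeffIdeal_span (unitBallToCBall E)
    (ReflectionPrimitive.reflQuot_sub_one_mem (isUniformizer_unit_mul h2 u) E hq hE hσ₀ β)
  rw [unitBallToCBall_algebraMap_generator,
    span_singleton_unit_mul_eq (isUnit_unitBallToCBall_algebraMap_unit u E)] at h
  exact h

/-- ★ … in J10's DIVISIBILITY currency, higher coefficients. -/
theorem two_dvd_coeff_succ_reflQuotC (β : RelNormCoherentUnits (isUniformizer_unit_mul h2 u) E) (n : ℕ) :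
    (2 : CBall F) ∣ PowerSeries.coeff (n + 1) (reflQuotC hq h2 u E hE hσ₀ β) :=
  (sub_one_mem_coeffIdeal_span_iff.mp (reflQuotC_sub_one_mem hq h2 u E hE hσ₀ β)).2 n

/-- ★ … constant coefficient: `2 ∣ Q̄_β(0) − 1` (so `Q̄_β(0) = g_β(0)/g_β(ω₁')` is a principal unit, NOT `1`). -/
theorem two_dvd_constantCoeff_reflQuotC_sub_one (β : RelNormCoherentUnits (isUniformizer_unit_mul h2 u) E) :
    (2 : CBall F) ∣ PowerSeries.constantCoeff (reflQuotC hq h2 u E hE hσ₀ β) - 1 :=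
  (sub_one_mem_coeffIdeal_span_iff.mp (reflQuotC_sub_one_mem hq h2 u E hE hσ₀ β)).1

include h2 in
/-- `Q̄_β(0)` is a unit of `𝒪_ℂ` (principal ⟹ unit). -/
theorem isUnit_constantCoeff_reflQuotC (β : RelNormCoherentUnits (isUniformizer_unit_mul h2 u) E) :
    IsUnit (PowerSeries.constantCoeff (reflQuotC hq h2 u E hE hσ₀ β)) :=
  isUnit_of_norm_sub_one_lt_one
    (norm_sub_one_lt_one_of_two_dvd (norm_two_lt_one_C h2) (two_dvd_constantCoeff_reflQuotC_sub_one hq h2 u E hE hσ₀ β))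

/-- THE GAUGE UNIT `a_β := Q̄_β(0) ∈ 𝒪_ℂˣ`. -/
def gaugeUnit (β : RelNormCoherentUnits (isUniformizer_unit_mul h2 u) E) : (CBall F)ˣ :=
  (isUnit_constantCoeff_reflQuotC hq h2 u E hE hσ₀ β).unit

/-- `a_β = Q̄_β(0)` (unfolding). -/
theorem coe_gaugeUnit (β : RelNormCoherentUnits (isUniformizer_unit_mul h2 u) E) :
    (gaugeUnit hq h2 u E hE hσ₀ β : CBall F) = PowerSeries.constantCoeff (reflQuotC hq h2 u E hE hσ₀ β) := rfl

/-- ★ **THE NORMALISED REFLECTION QUOTIENT `P_β := a_β⁻¹ · Q̄_β ∈ 𝒪_ℂ⟦X⟧`** — J10's `P`. -/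
def reflQuotN (β : RelNormCoherentUnits (isUniformizer_unit_mul h2 u) E) : PowerSeries (CBall F) :=
  PowerSeries.C ((↑(gaugeUnit hq h2 u E hE hσ₀ β)⁻¹ : CBall F)) * reflQuotC hq h2 u E hE hσ₀ β

/-- ★ J10's `hP0` for the witness. -/
theorem constantCoeff_reflQuotN (β : RelNormCoherentUnits (isUniformizer_unit_mul h2 u) E) :
    PowerSeries.constantCoeff (reflQuotN hq h2 u E hE hσ₀ β) = 1 :=
  constantCoeff_C_inv_mul (gaugeUnit hq h2 u E hE hσ₀ β) (coe_gaugeUnit hq h2 u E hE hσ₀ β).symm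

/-- ★ J10's `hP` for the witness. -/
theorem two_dvd_coeff_succ_reflQuotN (β : RelNormCoherentUnits (isUniformizer_unit_mul h2 u) E) (n : ℕ) :
    (2 : CBall F) ∣ PowerSeries.coeff (n + 1) (reflQuotN hq h2 u E hE hσ₀ β) :=
  dvd_coeff_succ_C_mul _ (two_dvd_coeff_succ_reflQuotC hq h2 u E hE hσ₀ β) n

end Witness

end Summit.BirchSwinnertonDyer.Rank1Residual.P2.InstTwoCore

end
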